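import Literature.Analysis.SpecialFunctions.MellinSin
import Literature.NumberTheory.LFunctions.NymanBeurlingProofs
import Literature.NumberTheory.LFunctions.ZetaZerosReflection
import Literature.NumberTheory.LFunctions.ZetaSqReflectionPrinciple
import HarnessLib

/-!
# Báez-Duarte's reflection `U`: the symbol `s χ̃(s)/(1-s)`, the functions `{at}/(at)` and
# `sin(2πt)/(πt)`, and their Mellin transforms

Topic `Literature/NumberTheory/LFunctions` (Nyman–Beurling circle). Báez-Duarte (*A class of
invariant unitary operators*, Adv. Math. 144 (1999)) attached to the Nyman–Beurling problem the
dilation-invariant unitary operator `U` of `L²(0,∞)` whose Mellin multiplier on the critical line is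
`U(s) = (s/(1-s)) ζ(1-s)/ζ(s)`; it sends the Beurling function `ρ_a(t) = {1/(at)}` to its "time
reversal" `{at}/(at)` and `χ = 𝟙_{(0,1]}` to `sin(2πt)/(πt)` (Burnol, Adv. Math. 170 (2002), §3 and
proof of Thm. 5.3; Báez-Duarte–Balazard–Landreau–Saias, Adv. Math. 149 (2000), "Notes … 3", used `U`
for their lower bound `D(λ) ≫ 1/√log(1/λ)`). This file provides the function-level content of that
statement, entirely through absolutely convergent Mellin transforms (no `L²` operator is built):

* for the tree's `feFactor s = 2(2π)^{-s} Γ(s) cos(πs/2)` (`Literature.NumberTheory.LFunctions.ZetaM4.feFactor`,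
  `ZetaSqReflectionPrinciple.lean`; `ζ(1-s) = feFactor s · ζ(s)` is Mathlib's `riemannZeta_one_sub`,
  Titchmarsh (2.1.8)): `|feFactor(1/2+iτ)| = 1` (`norm_feFactor_half`, sharpening the tree's
  `ZetaM4.norm_feFactor_half_le`);
* the symbol `uSymbol s = s · feFactor s/(1-s)`: unimodular on the critical line
  (`norm_uSymbol_half`), holomorphic and zero-free on `0 < Re s < 1`;
* `fractDiv a t = {at}/(at)`: `≡ 1` on `(0,1/a)`, bounded by `min(1, 1/(at))`, in `L²`, with
  `∫_0^∞ ({at}/(at)) t^{s-1} dt = -a^{-s} ζ(1-s)/(1-s)` on `0 < Re s < 1` (`hasMellin_fractDiv`,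
  from Titchmarsh (2.1.5) `∫_0^∞ {1/t}t^{w-1}dt = -ζ(w)/w`, `Literature.NumberTheory.LFunctions.mellin_fract_one_div_eq`, at
  `w = 1-s` after `t ↦ 1/t`);
* `sincKernel t = sin(2πt)/(πt)` (`Literature/Analysis/SpecialFunctions/MellinSin.lean`): in `L²`,
  with `∫_0^∞ sincKernel(t) t^{s-1} dt = feFactor s/(1-s)` (`mellin_sincKernel_eq`).

Consequently `M[{at}/(at)] = uSymbol · M[{1/(at)}]` and `M[sincKernel] = uSymbol · M[χ]` on the
critical line; the next step of the proof of `Literature.Barriers.RiemannHypothesis.BDBLS2000_uniform` turns this into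
`‖Uf‖₂ = ‖f‖₂` for `f = χ - Σ c_j ρ_{a_j}` via Mellin–Plancherel
(`Literature.Analysis.FunctionSpaces.integral_norm_sq_mellin_half_eq`).

## References

* L. Báez-Duarte, *A class of invariant unitary operators*, Adv. Math. 144 (1999), 1–12.
* J.-F. Burnol, *A lower bound in an approximation problem involving the zeros of the Riemann zeta
  function*, Adv. Math. 170 (2002), 56–70, §3 ("`ζ(s)/s = -∫_0^∞ ρ(1/t)t^{s-1}dt` … shows that `U`
  is the phase operator associated with `ρ(1/t)`"), proof of Thm. 5.3 ("`Uχ` is `sin(2πt)/(πt)`").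
* E. C. Titchmarsh, *The Theory of the Riemann Zeta-Function*, 2nd ed. (rev. Heath-Brown), OUP
  1986, §2.1: (2.1.5) `ζ(s) = s∫_0^∞([x]-x)x^{-s-1}dx` (`0 < σ < 1`) and (2.1.8)
  `ζ(1-s) = 2^{1-s}π^{-s}cos(½sπ)Γ(s)ζ(s)` (p. 16).
-/

noncomputable section

open Complex MeasureTheory Set Filter
open scoped Real Topology ComplexConjugate

namespace Literature.NumberTheory.LFunctions

namespace BaezDuarteU

/-! ## The factor of the functional equation and the symbol of `U` -/

open ZetaM4 (feFactor)

/-- Riemann's functional equation `ζ(1-s) = χ̃(s) ζ(s)` away from `s = 1` and the non-positive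
integers (Mathlib `riemannZeta_one_sub`). [cite: Titchmarsh1986, §2.1 (2.1.8)] -/
theorem riemannZeta_one_sub_eq_feFactor_mul {s : ℂ} (hs : ∀ n : ℕ, s ≠ -n) (hs1 : s ≠ 1) :
    riemannZeta (1 - s) = feFactor s * riemannZeta s := by
  rw [riemannZeta_one_sub hs hs1, ZetaM4.feFactor]

/-- `‖Γ(1/2 + iτ)‖² = π/cosh(πτ)` (reflection formula with `1 - s = s̄`). [folklore] -/
lemma norm_sq_Gamma_half (τ : ℝ) : ‖Gamma (1 / 2 + τ * I)‖ ^ 2 = π / Real.cosh (π * τ) := by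
  set s : ℂ := 1 / 2 + τ * I with hs
  have hconj : conj s = 1 - s := by
    simp only [hs, map_add, map_mul, Complex.conj_I, map_div₀, map_one, Complex.conj_ofReal]
    rw [show (starRingEnd ℂ) (2 : ℂ) = 2 from map_ofNat _ 2]
    ring
  have h1 := Complex.Gamma_mul_Gamma_one_sub s
  rw [← hconj, Complex.Gamma_conj, Complex.mul_conj, Complex.normSq_eq_norm_sq] at h1
  have hsin : Complex.sin (π * s) = Real.cosh (π * τ) := by
    rw [hs, mul_add, show (π : ℂ) * (1 / 2) = π / 2 by ring, add_comm, Complex.sin_add_pi_div_two,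
      show (π : ℂ) * (τ * I) = (π * τ) * I by ring, Complex.cos_mul_I]
    push_cast
    rfl
  rw [hsin] at h1
  have hcosh : (Real.cosh (π * τ) : ℂ) ≠ 0 := by exact_mod_cast (Real.cosh_pos _).ne'
  have h2 : ((‖Gamma s‖ ^ 2 : ℝ) : ℂ) = ((π / Real.cosh (π * τ) : ℝ) : ℂ) := by
    rw [h1]; push_cast; rfl
  exact_mod_cast h2

/-- `‖cos(π(1/2+iτ)/2)‖² = cosh(πτ)/2`. [folklore] -/
lemma norm_sq_cos_half (τ : ℝ) :
    ‖Complex.cos (π * (1 / 2 + τ * I) / 2)‖ ^ 2 = Real.cosh (π * τ) / 2 := by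
  have hz : (π : ℂ) * (1 / 2 + τ * I) / 2 = (π / 4 : ℝ) + (π * τ / 2 : ℝ) * I := by
    push_cast; ring
  rw [hz, Complex.cos_eq]
  simp only [add_re, ofReal_re, mul_re, I_re, mul_zero, ofReal_im, I_im, mul_one, sub_self,
    add_zero, add_im, mul_im, zero_add]
  rw [← Complex.normSq_eq_norm_sq]
  have : Complex.cos ↑(π / 4) * Complex.cosh ↑(π * τ / 2) - Complex.sin ↑(π / 4) * Complex.sinh ↑(π * τ / 2) * I
      = ((Real.cos (π / 4) * Real.cosh (π * τ / 2) : ℝ) : ℂ) +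
        ((-(Real.sin (π / 4) * Real.sinh (π * τ / 2)) : ℝ) : ℂ) * I := by
    push_cast; ring
  rw [this, Complex.normSq_add_mul_I, Real.cos_pi_div_four, Real.sin_pi_div_four]
  have h2 : Real.sqrt 2 ^ 2 = 2 := Real.sq_sqrt (by norm_num)
  have hc : Real.cosh (π * τ) = Real.cosh (π * τ / 2) ^ 2 + Real.sinh (π * τ / 2) ^ 2 := by
    rw [← Real.cosh_two_mul]; congr 1; ring
  rw [hc]
  nlinarith [h2]

/-- **`|χ̃| = 1` on the critical line**: `‖2(2π)^{-s}Γ(s)cos(πs/2)‖ = 1` for `s = 1/2 + iτ`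
(consistent with `|ζ(1/2-iτ)| = |ζ(1/2+iτ)|`; sharpens the tree's `ZetaM4.norm_feFactor_half_le`).
[cite: Titchmarsh1986, §2.1 (2.1.8)] -/
theorem norm_feFactor_half (τ : ℝ) : ‖feFactor (1 / 2 + τ * I)‖ = 1 := by
  have h2π : (0 : ℝ) < 2 * π := by positivity
  have hpow : ‖(2 * π : ℂ) ^ (-(1 / 2 + τ * I))‖ = (2 * π) ^ (-(1 / 2) : ℝ) := by
    rw [show (2 * π : ℂ) = ((2 * π : ℝ) : ℂ) by push_cast; ring, norm_cpow_eq_rpow_re_of_pos h2π]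
    congr 1; simp
  have hsq : ‖feFactor (1 / 2 + τ * I)‖ ^ 2 = 1 := by
    unfold ZetaM4.feFactor
    rw [norm_mul, norm_mul, norm_mul, hpow, Complex.norm_two]
    rw [show (2 * (2 * π) ^ (-(1 / 2) : ℝ) * ‖Gamma (1 / 2 + τ * I)‖ *
        ‖Complex.cos (π * (1 / 2 + τ * I) / 2)‖) ^ 2 =
        4 * ((2 * π) ^ (-(1 / 2) : ℝ)) ^ 2 * ‖Gamma (1 / 2 + τ * I)‖ ^ 2 *
          ‖Complex.cos (π * (1 / 2 + τ * I) / 2)‖ ^ 2 by ring]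
    rw [norm_sq_Gamma_half, norm_sq_cos_half, ← Real.rpow_natCast, ← Real.rpow_mul h2π.le]
    norm_num
    rw [Real.rpow_neg_one]
    have hcosh : Real.cosh (π * τ) ≠ 0 := (Real.cosh_pos _).ne'
    field_simp
    norm_num
  have h0 : 0 ≤ ‖feFactor (1 / 2 + τ * I)‖ := norm_nonneg _
  nlinarith [hsq, h0]

/-- The Mellin multiplier `U(s) = s χ̃(s)/(1-s)` of Báez-Duarte's unitary operator `U`
(`= (s/(1-s)) ζ(1-s)/ζ(s)` wherever `ζ(s) ≠ 0`; Burnol: "its spectral multiplier is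
`(s/(1-s)) ζ(1-s)/ζ(s)`"). Only used on the open strip `0 < Re s < 1`; at `s = 1` Lean's `x/0 = 0`
gives the junk value `0`. [cite: Burnol2002, §3] -/
def uSymbol (s : ℂ) : ℂ :=
  s * feFactor s / (1 - s)

/-- **`U` is unitary**: `|U(1/2+iτ)| = 1`. [cite: Burnol2002, §3] -/
theorem norm_uSymbol_half (τ : ℝ) : ‖uSymbol (1 / 2 + τ * I)‖ = 1 := by
  unfold uSymbol
  rw [norm_div, norm_mul, norm_feFactor_half, mul_one]
  have h1 : ‖(1 / 2 + τ * I : ℂ)‖ ^ 2 = ‖(1 - (1 / 2 + τ * I) : ℂ)‖ ^ 2 := by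
    rw [← Complex.normSq_eq_norm_sq, ← Complex.normSq_eq_norm_sq,
      show (1 / 2 + τ * I : ℂ) = ((1 / 2 : ℝ) : ℂ) + (τ : ℝ) * I by push_cast; ring,
      show (1 - (((1 / 2 : ℝ) : ℂ) + (τ : ℝ) * I) : ℂ) = ((1 / 2 : ℝ) : ℂ) + ((-τ : ℝ) : ℂ) * I by
        push_cast; ring,
      Complex.normSq_add_mul_I, Complex.normSq_add_mul_I]
    ring
  have hpos : 0 < ‖(1 - (1 / 2 + τ * I) : ℂ)‖ := by
    rw [norm_pos_iff]; intro h
    have := congrArg Complex.re h; simp at this; norm_num at this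
  have h2 : ‖(1 / 2 + τ * I : ℂ)‖ = ‖(1 - (1 / 2 + τ * I) : ℂ)‖ := by
    nlinarith [norm_nonneg (1 / 2 + τ * I : ℂ), h1, hpos]
  rw [h2, div_self hpos.ne']

/-- `U(s) ≠ 0` for `0 < Re s < 1`. [folklore] -/
theorem uSymbol_ne_zero {s : ℂ} (hs0 : 0 < s.re) (hs1 : s.re < 1) : uSymbol s ≠ 0 := by
  unfold uSymbol
  have hs : s ≠ 0 := fun h ↦ by simp [h] at hs0
  have h1s : 1 - s ≠ 0 := fun h ↦ by
    have := congrArg Complex.re h; simp at this; linarith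
  have hF : feFactor s ≠ 0 := riemannZeta_feFactor_ne_zero hs0 hs1
  exact div_ne_zero (mul_ne_zero hs hF) h1s

/-- `U` is holomorphic on the strip `0 < Re s < 1`. [folklore] -/
theorem differentiableAt_uSymbol {s : ℂ} (hs0 : 0 < s.re) (hs1 : s.re < 1) :
    DifferentiableAt ℂ uSymbol s := by
  have h1s : 1 - s ≠ 0 := fun h ↦ by
    have := congrArg Complex.re h; simp at this; linarith
  unfold uSymbol
  exact (differentiableAt_id.mul (ZetaM4.differentiableAt_feFactor (ne_neg_nat_of_re_pos hs0))).div
    ((differentiableAt_const _).sub differentiableAt_id) h1s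

/-- `U` is continuous on the strip `0 < Re s < 1`. [folklore] -/
theorem continuousOn_uSymbol : ContinuousOn uSymbol {s : ℂ | 0 < s.re ∧ s.re < 1} :=
  fun _ hs ↦ (differentiableAt_uSymbol hs.1 hs.2).continuousAt.continuousWithinAt

/-! ## The time-reversed Beurling function `{at}/(at)` -/

/-- Báez-Duarte's `U ρ_a`: the function `t ↦ {at}/(at)` (`{·}` the fractional part), the "time
reversal" `{t}/t` of `ρ(1/t) = {1/t}` dilated by `a` (Burnol: "`U` sends `f` to `J(f)`",
`J(g)(t) = conj(g(1/t))/t`), complex-valued. At `at = 0` real division gives the junk value `0`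
(a single point, irrelevant for the `L²`/Mellin statements below, which live on `t > 0`, `a > 0`).
[cite: Burnol2002, §3] -/
def fractDiv (a t : ℝ) : ℂ :=
  ((Int.fract (a * t) / (a * t) : ℝ) : ℂ)

/-- `{at}/(at) = 1` for `0 < at < 1`. [folklore] -/
theorem fractDiv_eq_one {a t : ℝ} (h0 : 0 < a * t) (h1 : a * t < 1) : fractDiv a t = 1 := by
  unfold fractDiv
  rw [Int.fract_eq_self.2 ⟨h0.le, h1⟩, div_self h0.ne']
  simp

/-- `‖{at}/(at)‖ ≤ 1` for `at ≥ 0`. [folklore] -/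
theorem norm_fractDiv_le_one {a t : ℝ} (h0 : 0 ≤ a * t) : ‖fractDiv a t‖ ≤ 1 := by
  unfold fractDiv
  rw [Complex.norm_real, Real.norm_eq_abs, abs_div, abs_of_nonneg (Int.fract_nonneg _),
    abs_of_nonneg h0]
  rcases h0.eq_or_lt with h | h
  · rw [← h]; simp
  · rw [div_le_one h, ← Int.self_sub_floor, sub_le_self_iff]
    exact_mod_cast Int.floor_nonneg.2 h0

/-- `‖{at}/(at)‖ ≤ 1/(at)` for `at > 0`. [folklore] -/
theorem norm_fractDiv_le_inv {a t : ℝ} (h0 : 0 < a * t) : ‖fractDiv a t‖ ≤ 1 / (a * t) := by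
  unfold fractDiv
  rw [Complex.norm_real, Real.norm_eq_abs, abs_div, abs_of_nonneg (Int.fract_nonneg _),
    abs_of_pos h0]
  exact div_le_div_of_nonneg_right (Int.fract_lt_one _).le h0.le

/-- `fractDiv a` is measurable. [folklore] -/
theorem measurable_fractDiv (a : ℝ) : Measurable (fractDiv a) := by
  unfold fractDiv
  exact Complex.measurable_ofReal.comp ((measurable_fract.comp (by fun_prop)).div (by fun_prop))

/-- Dilation: `fractDiv a t = fractDiv 1 (a t)`. [folklore] -/
lemma fractDiv_eq_comp (a t : ℝ) : fractDiv a t = fractDiv 1 (a * t) := by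
  simp [fractDiv]

/-- On `t > 0`: `{t}/t = t^{-1} · {1/(t^{-1})}`, the form to which Mathlib's `mellin_cpow_smul` and
`mellin_comp_rpow` apply. [folklore] -/
lemma fractDiv_one_eq {t : ℝ} (ht : 0 < t) :
    fractDiv 1 t = (t : ℂ) ^ (-1 : ℂ) • (fun u : ℝ ↦ ((Int.fract (1 / u) : ℝ) : ℂ)) (t ^ (-1 : ℝ)) := by
  have ht' : (t : ℂ) ≠ 0 := by exact_mod_cast ht.ne'
  simp only [fractDiv, one_mul, smul_eq_mul, cpow_neg_one, Real.rpow_neg_one, one_div, inv_inv]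
  push_cast
  field_simp

/-- **Mellin transform of `{at}/(at)`**: for `a > 0` and `0 < Re s < 1`,
`∫_0^∞ ({at}/(at)) t^{s-1} dt = -a^{-s} ζ(1-s)/(1-s)` (from Titchmarsh (2.1.5) at `1-s` after
`t ↦ 1/t`; this is `U(s) · M[{1/(at)}](s) = U(s) · (-a^{-s}ζ(s)/s)`). [cite: Titchmarsh1986, §2.1 (2.1.5)] -/
theorem hasMellin_fractDiv {a : ℝ} (ha : 0 < a) {s : ℂ} (hs0 : 0 < s.re) (hs1 : s.re < 1) :
    HasMellin (fractDiv a) s (-(a : ℂ) ^ (-s) * riemannZeta (1 - s) / (1 - s)) := by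
  set F : ℝ → ℂ := fun u : ℝ ↦ ((Int.fract (1 / u) : ℝ) : ℂ) with hF
  have h1s0 : 0 < (1 - s).re := by simp; linarith
  have h1s1 : (1 - s).re < 1 := by simp; linarith
  -- `fractDiv 1`
  have hG : ∀ t ∈ Ioi (0 : ℝ), (t : ℂ) ^ (s - 1) • fractDiv 1 t =
      (t : ℂ) ^ (s - 1) • ((t : ℂ) ^ (-1 : ℂ) • F (t ^ (-1 : ℝ))) := fun t ht ↦ by
    rw [fractDiv_one_eq ht]
  have hconvF : MellinConvergent F (1 - s) :=
    BaezDuarteOnlyIf.mellinConvergent_fract_one_div h1s0 h1s1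
  have hconv1 : MellinConvergent (fractDiv 1) s := by
    have h1 : MellinConvergent (fun t : ℝ ↦ F (t ^ (-1 : ℝ))) (s + -1) := by
      refine (MellinConvergent.comp_rpow (by norm_num)).2 ?_
      convert hconvF using 1
      push_cast; ring
    have h2 := (MellinConvergent.cpow_smul (f := fun t : ℝ ↦ F (t ^ (-1 : ℝ))) (a := -1)).2 h1
    exact h2.congr_fun (fun t ht ↦ (hG t ht).symm) measurableSet_Ioi
  have hval1 : mellin (fractDiv 1) s = -riemannZeta (1 - s) / (1 - s) := by
    rw [mellin, setIntegral_congr_fun measurableSet_Ioi hG, ← mellin, mellin_cpow_smul,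
      mellin_comp_rpow]
    have e : (s + -1) / ((-1 : ℝ) : ℂ) = 1 - s := by push_cast; ring
    rw [e, hF, mellin_fract_one_div_eq h1s0 h1s1]
    simp
  -- dilate
  have hfun : fractDiv a = fun t ↦ fractDiv 1 (a * t) := funext (fractDiv_eq_comp a)
  refine ⟨?_, ?_⟩
  · rw [hfun]; exact (MellinConvergent.comp_mul_left ha).2 hconv1
  · rw [hfun, mellin_comp_mul_left _ _ ha, hval1, smul_eq_mul]
    ring

/-- `MellinConvergent` form. [cite: Titchmarsh1986, §2.1 (2.1.5)] -/
theorem mellinConvergent_fractDiv {a : ℝ} (ha : 0 < a) {s : ℂ} (hs0 : 0 < s.re) (hs1 : s.re < 1) :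
    MellinConvergent (fractDiv a) s :=
  (hasMellin_fractDiv ha hs0 hs1).1

/-- `{at}/(at) ∈ L²((0,∞))` for `a ≥ 1` (bounded by `𝟙_{(0,1]} + 𝟙_{(1,∞)} t^{-1}`). [folklore] -/
theorem memLp_two_fractDiv {a : ℝ} (ha : 1 ≤ a) :
    MemLp (fractDiv a) 2 (volume.restrict (Ioi (0 : ℝ))) := by
  have ha0 : 0 < a := by linarith
  set g : ℝ → ℝ := fun x ↦ (Ioc (0 : ℝ) 1).indicator (fun _ ↦ (1 : ℝ)) x +
    (Ioi (1 : ℝ)).indicator (fun x ↦ x⁻¹) x with hg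
  have hg1 : MemLp ((Ioc (0 : ℝ) 1).indicator fun _ ↦ (1 : ℝ)) 2 (volume.restrict (Ioi (0 : ℝ))) :=
    memLp_indicator_const 2 measurableSet_Ioc 1 (Or.inr (by
      rw [Measure.restrict_apply measurableSet_Ioc]
      exact ((measure_mono inter_subset_left).trans_lt measure_Ioc_lt_top).ne))
  have hg2 : MemLp ((Ioi (1 : ℝ)).indicator fun x : ℝ ↦ x⁻¹) 2 (volume.restrict (Ioi (0 : ℝ))) := by
    rw [memLp_indicator_iff_restrict measurableSet_Ioi, Measure.restrict_restrict measurableSet_Ioi,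
      Ioi_inter_Ioi, show max (1 : ℝ) 0 = 1 by norm_num]
    refine ⟨by fun_prop, ?_⟩
    rw [eLpNorm_inv_Ioi_one]
    exact ENNReal.one_lt_top
  have hgL2 : MemLp g 2 (volume.restrict (Ioi (0 : ℝ))) := hg1.add hg2
  refine hgL2.mono' (measurable_fractDiv a).aestronglyMeasurable ?_
  filter_upwards [ae_restrict_mem measurableSet_Ioi] with x (hx : 0 < x)
  have hax : 0 < a * x := by positivity
  by_cases hx1 : x ≤ 1
  · have : x ∉ Ioi (1 : ℝ) := fun h ↦ absurd hx1 (not_le.2 h)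
    simp only [hg, indicator_of_mem (show x ∈ Ioc (0 : ℝ) 1 from ⟨hx, hx1⟩),
      indicator_of_notMem this, add_zero]
    exact norm_fractDiv_le_one hax.le
  · rw [not_le] at hx1
    have : x ∉ Ioc (0 : ℝ) 1 := fun h ↦ absurd h.2 (not_le.2 hx1)
    simp only [hg, indicator_of_notMem this, indicator_of_mem (show x ∈ Ioi (1 : ℝ) from hx1),
      zero_add]
    calc ‖fractDiv a x‖ ≤ 1 / (a * x) := norm_fractDiv_le_inv hax
      _ ≤ x⁻¹ := by
        rw [one_div, mul_inv]
        exact mul_le_of_le_one_left (inv_nonneg.2 hx.le) (inv_le_one_of_one_le₀ ha)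

/-! ## The kernel `sin(2πt)/(πt) = Uχ` -/

/-- **`M[sin(2πt)/(πt)](s) = χ̃(s)/(1-s)`** on `0 < Re s < 1` (from
`Literature.Analysis.SpecialFunctions.hasMellin_sincKernel` and `Γ(s) = (s-1)Γ(s-1)`); i.e. `M[Uχ] = U(s)·M[χ] = U(s)/s`.
[cite: Burnol2002, proof of Thm. 5.3] -/
theorem mellin_sincKernel_eq {s : ℂ} (hs0 : 0 < s.re) (hs1 : s.re < 1) :
    mellin Literature.Analysis.SpecialFunctions.sincKernel s = feFactor s / (1 - s) := by
  rw [(Literature.Analysis.SpecialFunctions.hasMellin_sincKernel hs0 hs1).2, ZetaM4.feFactor]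
  have hs1' : s - 1 ≠ 0 := fun h ↦ by
    have := congrArg Complex.re h; simp at this; linarith
  have h1s : 1 - s ≠ 0 := fun h ↦ hs1' (by linear_combination -h)
  have hG : Gamma s = (s - 1) * Gamma (s - 1) := by
    have := Complex.Gamma_add_one (s - 1) hs1'
    rw [sub_add_cancel] at this
    exact this
  rw [hG]
  field_simp
  ring

/-- `sin(2πt)/(πt) ∈ L²((0,∞))` (bounded by `2·𝟙_{(0,1]} + 𝟙_{(1,∞)}(πt)^{-1}`). [folklore] -/
theorem memLp_two_sincKernel :
    MemLp Literature.Analysis.SpecialFunctions.sincKernel 2 (volume.restrict (Ioi (0 : ℝ))) := by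
  set g : ℝ → ℝ := fun x ↦ (Ioc (0 : ℝ) 1).indicator (fun _ ↦ (2 : ℝ)) x +
    (Ioi (1 : ℝ)).indicator (fun x ↦ x⁻¹) x with hg
  have hg1 : MemLp ((Ioc (0 : ℝ) 1).indicator fun _ ↦ (2 : ℝ)) 2 (volume.restrict (Ioi (0 : ℝ))) :=
    memLp_indicator_const 2 measurableSet_Ioc 2 (Or.inr (by
      rw [Measure.restrict_apply measurableSet_Ioc]
      exact ((measure_mono inter_subset_left).trans_lt measure_Ioc_lt_top).ne))
  have hg2 : MemLp ((Ioi (1 : ℝ)).indicator fun x : ℝ ↦ x⁻¹) 2 (volume.restrict (Ioi (0 : ℝ))) := by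
    rw [memLp_indicator_iff_restrict measurableSet_Ioi, Measure.restrict_restrict measurableSet_Ioi,
      Ioi_inter_Ioi, show max (1 : ℝ) 0 = 1 by norm_num]
    refine ⟨by fun_prop, ?_⟩
    rw [eLpNorm_inv_Ioi_one]
    exact ENNReal.one_lt_top
  have hgL2 : MemLp g 2 (volume.restrict (Ioi (0 : ℝ))) := hg1.add hg2
  refine hgL2.mono'
    Literature.Analysis.SpecialFunctions.measurable_sincKernel.aestronglyMeasurable ?_
  filter_upwards [ae_restrict_mem measurableSet_Ioi] with x (hx : 0 < x)
  by_cases hx1 : x ≤ 1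
  · have : x ∉ Ioi (1 : ℝ) := fun h ↦ absurd hx1 (not_le.2 h)
    simp only [hg, indicator_of_mem (show x ∈ Ioc (0 : ℝ) 1 from ⟨hx, hx1⟩),
      indicator_of_notMem this, add_zero]
    exact Literature.Analysis.SpecialFunctions.norm_sincKernel_le_two x
  · rw [not_le] at hx1
    have : x ∉ Ioc (0 : ℝ) 1 := fun h ↦ absurd h.2 (not_le.2 hx1)
    simp only [hg, indicator_of_notMem this, indicator_of_mem (show x ∈ Ioi (1 : ℝ) from hx1),
      zero_add]
    calc ‖Literature.Analysis.SpecialFunctions.sincKernel x‖ ≤ 1 / (π * |x|) :=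
          Literature.Analysis.SpecialFunctions.norm_sincKernel_le_inv hx.ne'
      _ ≤ x⁻¹ := by
        rw [abs_of_pos hx, one_div, mul_inv]
        refine mul_le_of_le_one_left (inv_nonneg.2 hx.le) ?_
        exact inv_le_one_of_one_le₀ (by linarith [Real.pi_gt_three])

end BaezDuarteU

end Literature.NumberTheory.LFunctions
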